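import Literature.AlgebraicGeometry.Frobenioids.EquivalencePreStepsFSMFF2024
import Literature.AlgebraicGeometry.Frobenioids.EquivalenceFrobeniusQuasiIsotropic
import HarnessLib

/-!
# Frobenioids I, Theorem 3.4 (ii) over bases of FSMFF-type in the author's revised (2024) sense

Mochizuki, *The geometry of Frobenioids I: the general theory*, Kyushu J. Math. **62** (2008)
293–400, Thm. 3.4 (ii), kurims p. 62 [cite: MochizukiFrdI2008, Thm. 3.4 (ii) p.62]:

> "(ii) Suppose that `C₁`, `C₂` are of quasi-isotropic type, and that `D₁`, `D₂` are of FSMFF-type.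
> Then `Ψ` preserves pre-steps, co-angular pre-steps, and group-like objects."

with "FSMFF-type" read in the sense of the author's *Comments on "The geometry of Frobenioids I"*
(January 2024), item (28) [cite: MochizukiFrdIComments2024, (28) p.3] (`IsOfFSMFFType2024`), i.e.
THE STATEMENT AS THE AUTHOR CURRENTLY ASSERTS IT. Proof as printed (p. 63): "By assertion (i) [cf.
also Proposition 1.9, (v)], and the characterization of co-angular pre-steps given in Proposition
1.7, (iv), we reduce immediately to the case where `C₁`, `C₂` are of isotropic type" — the isotropic
case being `FrdI.isPreStep_map_of_isOfFSMFFType2024` / `FrdI.isGroupLikeObj_map_of_isOfFSMFFType2024`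
of `EquivalencePreStepsFSMFF2024.lean` (printed route through Prop. 1.14 (ii), (iii) [revised]).

PROOF-ONLY file (seat abc-iut-L1-t11). The REDUCTION below is ADAPTED VERBATIM from seat
abc-iut-L1-t13's `EquivalencePreStepsQuasiIsotropic.lean` (`isPreStep_map_of_quasiIsotropic_of_isOfFSMType`,
`isCoAngularPreStep_map_…`, `isGroupLikeObj_map_…`, `thm34ii_of_isOfFSMType`, there for bases of
FSM-type): restriction of `Ψ` to `Ψ^istr : C₁^istr ≌ C₂^istr` (Thm. 3.4 (i), Prop. 1.9 (v);
`FrdI.isotropicObjects_inverseImage` of `EquivalenceFrobeniusQuasiIsotropic.lean`),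
isotropic hulls (Def. 1.3 (vii)(a)) and Prop. 1.7 (iv)/(v); only the isotropic core and the base
hypotheses (`IsOfFSMType` ↦ `IsOfFSMFFType2024`) differ. Result: `FrdI.thm34ii_of_isOfFSMFFType2024`
— all three clauses of Thm. 3.4 (ii) for Frobenioids of quasi-isotropic type over bases of FSMFF-type
(revised). The 2008-worded named fact `FrdI.Thm34ii` (hypotheses `IsOfFSMFFType`, printed (b)) is NOT
asserted or discharged here; no statement of the paper is strengthened.
-/

set_option backward.isDefEq.respectTransparency false

namespace Literature.AlgebraicGeometry.Frobenioids

open CategoryTheory Opposite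

universe w v v' u u'

namespace FrdI

section Two

variable {D₁ : Type u} [Category.{v} D₁] {Φ₁ : D₁ᵒᵖ ⥤ CommMonCat.{w}} {C₁ : Type u'}
  [Category.{v'} C₁] {D₂ : Type u} [Category.{v} D₂] {Φ₂ : D₂ᵒᵖ ⥤ CommMonCat.{w}} {C₂ : Type u'}
  [Category.{v'} C₂] {F₁ : C₁ ⥤ ElemFrobenioid Φ₁} {F₂ : C₂ ⥤ ElemFrobenioid Φ₂}

/-- **Thm. 3.4 (ii), pre-steps — quasi-isotropic type, bases of FSMFF-type (revised)**: `Ψ` preserves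
pre-steps (reduction to `C^istr` through isotropic hulls, as printed p. 63 and as formalised by seat
abc-iut-L1-t13 for FSM-type bases, + the isotropic core `isPreStep_map_of_isOfFSMFFType2024`).
[cite: MochizukiFrdI2008, Thm. 3.4 (ii) p.63] [cite: MochizukiFrdIComments2024, (28) pp.3-4] -/
theorem isPreStep_map_of_quasiIsotropic_of_isOfFSMFFType2024 (hF₁ : PreFrobenioid.IsFrobenioid F₁)
    (hF₂ : PreFrobenioid.IsFrobenioid F₂)
    (hq₁ : (PreFrobenioidData.ofFunctor Φ₁ F₁).IsOfQuasiIsotropicType)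
    (hq₂ : (PreFrobenioidData.ofFunctor Φ₂ F₂).IsOfQuasiIsotropicType) (hD₁ : IsOfFSMFFType2024 D₁)
    (hD₂ : IsOfFSMFFType2024 D₂) (Ψ : C₁ ≌ C₂) {A B : C₁} {φ : A ⟶ B}
    (hφ : PreFrobenioid.IsPreStep F₁ φ) : PreFrobenioid.IsPreStep F₂ (Ψ.functor.map φ) := by
  have hP₁ := hF₁.isPreFrobenioid
  have hP₂ := hF₂.isPreFrobenioid
  -- `Ψ^istr : C₁^istr ≌ C₂^istr`
  haveI : (PreFrobenioid.isotropicObjects F₂).IsClosedUnderIsomorphisms :=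
    ⟨fun e hX => PreFrobenioid.IsIsotropic.of_iso hP₂ e.symm hX⟩
  let Ψi : PreFrobenioid.Istr F₁ ≌ PreFrobenioid.Istr F₂ :=
    Ψ.congrFullSubcategory (isotropicObjects_inverseImage hF₁ hq₁ hq₂ Ψ)
  -- isotropic hulls of the endpoints and the induced pre-step between them
  obtain ⟨A', hA, hhA⟩ := hF₁.vii_a A
  obtain ⟨B', hB, hhB⟩ := hF₁.vii_a B
  obtain ⟨-, hpA, hA'i, hunivA⟩ := id hhA
  obtain ⟨-, hpB, hB'i, -⟩ := id hhB
  obtain ⟨φ', hφ', -⟩ := hunivA (φ ≫ hB) hB'i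
  have hφ'p : PreFrobenioid.IsPreStep F₁ φ' :=
    (PreFrobenioid.isPreStep_factors F₁ hP₁.isTotallyEpimorphic_base
      (show PreFrobenioid.IsPreStep F₁ (hA ≫ φ') by
        rw [hφ']; exact PreFrobenioid.IsPreStep.comp F₁ hφ hpB)).1
  -- apply the isotropic core to `Ψ^istr`
  let a : PreFrobenioid.Istr F₁ := ⟨A', hA'i⟩
  let b : PreFrobenioid.Istr F₁ := ⟨B', hB'i⟩
  let f : a ⟶ b := ObjectProperty.homMk φ'
  have hf : PreFrobenioid.IsPreStep (PreFrobenioid.istrFunctor F₁) f := hφ'p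
  have hcore := isPreStep_map_of_isOfFSMFFType2024 (PreFrobenioid.isFrobenioid_istr hF₁)
    (PreFrobenioid.isFrobenioid_istr hF₂) (fun X => PreFrobenioid.isIsotropic_istr X)
    (fun X => PreFrobenioid.isIsotropic_istr X) hD₁ hD₂ Ψi hf
  have hΨφ' : PreFrobenioid.IsPreStep F₂ (Ψ.functor.map φ') := hcore
  -- transfer along the hulls: `Ψφ ≫ Ψh_B = Ψh_A ≫ Ψφ'`
  obtain ⟨-, hΨhAp, -, -⟩ := isIsotropicHull_map hF₁ hF₂ hq₁ hq₂ Ψ hhA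
  have hcomp : PreFrobenioid.IsPreStep F₂ (Ψ.functor.map φ ≫ Ψ.functor.map hB) := by
    rw [← Functor.map_comp, ← hφ', Functor.map_comp]
    exact PreFrobenioid.IsPreStep.comp F₂ hΨhAp hΨφ'
  exact (PreFrobenioid.isPreStep_factors F₂ hP₂.isTotallyEpimorphic_base hcomp).2

/-- **Thm. 3.4 (ii), co-angular pre-steps — quasi-isotropic type, bases of FSMFF-type (revised)**
(Prop. 1.7 (iv): a pre-step is co-angular iff mid-adjoint to the isometric pre-steps, which `Ψ⁻¹`
preserves by Thm. 3.4 (i); reduction of seat abc-iut-L1-t13).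
[cite: MochizukiFrdI2008, Thm. 3.4 (ii) p.63] [cite: MochizukiFrdIComments2024, (28) pp.3-4] -/
theorem isCoAngularPreStep_map_of_quasiIsotropic_of_isOfFSMFFType2024
    (hF₁ : PreFrobenioid.IsFrobenioid F₁) (hF₂ : PreFrobenioid.IsFrobenioid F₂)
    (hq₁ : (PreFrobenioidData.ofFunctor Φ₁ F₁).IsOfQuasiIsotropicType)
    (hq₂ : (PreFrobenioidData.ofFunctor Φ₂ F₂).IsOfQuasiIsotropicType) (hD₁ : IsOfFSMFFType2024 D₁)
    (hD₂ : IsOfFSMFFType2024 D₂) (Ψ : C₁ ≌ C₂) {A B : C₁} {φ : A ⟶ B}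
    (hφ : PreFrobenioid.IsCoAngularPreStep F₁ φ) :
    PreFrobenioid.IsCoAngularPreStep F₂ (Ψ.functor.map φ) := by
  have hp := isPreStep_map_of_quasiIsotropic_of_isOfFSMFFType2024 hF₁ hF₂ hq₁ hq₂ hD₁ hD₂ Ψ hφ.2
  refine ⟨?_, hp⟩
  rw [PreFrobenioid.isCoAngular_iff_isMidAdjoint_of_isPreStep F₂ hF₂ _ hp]
  have h1 := (PreFrobenioid.isCoAngular_iff_isMidAdjoint_of_isPreStep F₁ hF₁ _ hφ.2).1 hφ.1
  refine h1.map_equivalence Ψ (fun X Y β hβ => ?_)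
  obtain ⟨hi, hpre⟩ := isIsometry_isPreStep_map hF₂ hF₁ hq₂ hq₁ Ψ.symm hβ.1 hβ.2
  exact ⟨hi, hpre⟩

/-- **Thm. 3.4 (ii), group-like objects — quasi-isotropic type, bases of FSMFF-type (revised)**
(through the isotropic hull, a base-isomorphism, and `isGroupLikeObj_map_of_isOfFSMFFType2024` on
`C^istr`; reduction of seat abc-iut-L1-t13).
[cite: MochizukiFrdI2008, Thm. 3.4 (ii) p.63] [cite: MochizukiFrdIComments2024, (28) pp.3-4] -/
theorem isGroupLikeObj_map_of_quasiIsotropic_of_isOfFSMFFType2024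
    (hF₁ : PreFrobenioid.IsFrobenioid F₁) (hF₂ : PreFrobenioid.IsFrobenioid F₂)
    (hq₁ : (PreFrobenioidData.ofFunctor Φ₁ F₁).IsOfQuasiIsotropicType)
    (hq₂ : (PreFrobenioidData.ofFunctor Φ₂ F₂).IsOfQuasiIsotropicType) (hD₁ : IsOfFSMFFType2024 D₁)
    (hD₂ : IsOfFSMFFType2024 D₂) (Ψ : C₁ ≌ C₂) {A : C₁} (hA : PreFrobenioid.IsGroupLikeObj F₁ A) :
    PreFrobenioid.IsGroupLikeObj F₂ (Ψ.functor.obj A) := by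
  have hP₁ := hF₁.isPreFrobenioid
  have hP₂ := hF₂.isPreFrobenioid
  haveI : (PreFrobenioid.isotropicObjects F₂).IsClosedUnderIsomorphisms :=
    ⟨fun e hX => PreFrobenioid.IsIsotropic.of_iso hP₂ e.symm hX⟩
  let Ψi : PreFrobenioid.Istr F₁ ≌ PreFrobenioid.Istr F₂ :=
    Ψ.congrFullSubcategory (isotropicObjects_inverseImage hF₁ hq₁ hq₂ Ψ)
  obtain ⟨A', h, hh⟩ := hF₁.vii_a A
  obtain ⟨-, hp, hA'i, -⟩ := id hh
  haveI : IsIso (PreFrobenioid.Base F₁ h) := hp.2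
  -- `A'` is group-like
  have hA' : PreFrobenioid.IsGroupLikeObj F₁ A' := fun x => by
    have := hA (pull Φ₁ (PreFrobenioid.Base F₁ h) x)
    exact (hP₁.isMonoidOn.isCharInjective (PreFrobenioid.Base F₁ h)).1 (this.trans (map_one _).symm)
  -- through `Ψ^istr`
  have hcore : PreFrobenioid.IsGroupLikeObj F₂ (Ψ.functor.obj A') :=
    isGroupLikeObj_map_of_isOfFSMFFType2024 (PreFrobenioid.isFrobenioid_istr hF₁)
      (PreFrobenioid.isFrobenioid_istr hF₂) (fun X => PreFrobenioid.isIsotropic_istr X)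
      (fun X => PreFrobenioid.isIsotropic_istr X) hD₁ hD₂ Ψi (A := ⟨A', hA'i⟩) hA'
  -- back along the base-isomorphism `Ψ h`
  obtain ⟨-, hΨhp, -, -⟩ := isIsotropicHull_map hF₁ hF₂ hq₁ hq₂ Ψ hh
  haveI : IsIso (PreFrobenioid.Base F₂ (Ψ.functor.map h)) := hΨhp.2
  intro x
  have hx : x = pull Φ₂ (PreFrobenioid.Base F₂ (Ψ.functor.map h))
      (pull Φ₂ (inv (PreFrobenioid.Base F₂ (Ψ.functor.map h))) x) := by
    rw [← pull_comp, IsIso.hom_inv_id, pull_id]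
  rw [hx, hcore (pull Φ₂ (inv (PreFrobenioid.Base F₂ (Ψ.functor.map h))) x), map_one]

/-- **[FrdI] Theorem 3.4 (ii) with "FSMFF-type" in the author's revised (2024) sense — PROVED**: for
Frobenioids `C₁`, `C₂` of quasi-isotropic type over base categories `D₁`, `D₂` of FSMFF-type
(revised condition (b), Comments (28)) and an equivalence `Ψ : C₁ ⥲ C₂`, "`Ψ` preserves pre-steps,
co-angular pre-steps, and group-like objects."
[cite: MochizukiFrdI2008, Thm. 3.4 (ii) p.62] [cite: MochizukiFrdIComments2024, (28) pp.3-4] -/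
theorem thm34ii_of_isOfFSMFFType2024 (hF₁ : PreFrobenioid.IsFrobenioid F₁)
    (hF₂ : PreFrobenioid.IsFrobenioid F₂)
    (hq₁ : (PreFrobenioidData.ofFunctor Φ₁ F₁).IsOfQuasiIsotropicType)
    (hq₂ : (PreFrobenioidData.ofFunctor Φ₂ F₂).IsOfQuasiIsotropicType) (hD₁ : IsOfFSMFFType2024 D₁)
    (hD₂ : IsOfFSMFFType2024 D₂) (Ψ : C₁ ≌ C₂) :
    PreFrobenioidData.PreservesMor Ψ.functor (PreFrobenioidData.ofFunctor Φ₁ F₁).IsPreStep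
        (PreFrobenioidData.ofFunctor Φ₂ F₂).IsPreStep ∧
      PreFrobenioidData.PreservesMor Ψ.functor (PreFrobenioidData.ofFunctor Φ₁ F₁).IsCoAngularPreStep
        (PreFrobenioidData.ofFunctor Φ₂ F₂).IsCoAngularPreStep ∧
      PreFrobenioidData.PreservesObj Ψ.functor (PreFrobenioidData.ofFunctor Φ₁ F₁).IsGroupLikeObj
        (PreFrobenioidData.ofFunctor Φ₂ F₂).IsGroupLikeObj := by
  refine ⟨fun A B φ hφ =>
      isPreStep_map_of_quasiIsotropic_of_isOfFSMFFType2024 hF₁ hF₂ hq₁ hq₂ hD₁ hD₂ Ψ hφ,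
    fun A B φ hφ => ?_,
    fun A hA => isGroupLikeObj_map_of_quasiIsotropic_of_isOfFSMFFType2024 hF₁ hF₂ hq₁ hq₂ hD₁ hD₂ Ψ hA⟩
  have h := isCoAngularPreStep_map_of_quasiIsotropic_of_isOfFSMFFType2024 hF₁ hF₂ hq₁ hq₂ hD₁ hD₂ Ψ
    ⟨(PreFrobenioidData.ofFunctor_isCoAngular F₁ φ).1 hφ.1, hφ.2⟩
  exact ⟨(PreFrobenioidData.ofFunctor_isCoAngular F₂ _).2 h.1, h.2⟩

/-- Under the revised base hypotheses the 2008-worded named fact applies verbatim to its own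
hypotheses when those are read in the revised sense: `FrdI.Thm34ii`'s conclusion for `Ψ` holds
whenever `D₁`, `D₂` are of FSMFF-type (revised) — stated in the shape of
`PreFrobenioidData.Thm34ii` with the two base hypotheses replaced.
[cite: MochizukiFrdI2008, Thm. 3.4 (ii) p.62] [cite: MochizukiFrdIComments2024, (28) pp.3-4] -/
theorem thm34ii_shape_of_isOfFSMFFType2024 (hF₁ : PreFrobenioid.IsFrobenioid F₁)
    (hF₂ : PreFrobenioid.IsFrobenioid F₂) (Ψ : C₁ ≌ C₂) (hD₁ : IsOfFSMFFType2024 D₁)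
    (hD₂ : IsOfFSMFFType2024 D₂) :
    (PreFrobenioidData.ofFunctor Φ₁ F₁).IsOfQuasiIsotropicType →
      (PreFrobenioidData.ofFunctor Φ₂ F₂).IsOfQuasiIsotropicType →
        PreFrobenioidData.PreservesMor Ψ.functor (PreFrobenioidData.ofFunctor Φ₁ F₁).IsPreStep
            (PreFrobenioidData.ofFunctor Φ₂ F₂).IsPreStep ∧
          PreFrobenioidData.PreservesMor Ψ.functor
              (PreFrobenioidData.ofFunctor Φ₁ F₁).IsCoAngularPreStep
              (PreFrobenioidData.ofFunctor Φ₂ F₂).IsCoAngularPreStep ∧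
          PreFrobenioidData.PreservesObj Ψ.functor (PreFrobenioidData.ofFunctor Φ₁ F₁).IsGroupLikeObj
            (PreFrobenioidData.ofFunctor Φ₂ F₂).IsGroupLikeObj :=
  fun hq₁ hq₂ => thm34ii_of_isOfFSMFFType2024 hF₁ hF₂ hq₁ hq₂ hD₁ hD₂ Ψ

end Two

end FrdI

end Literature.AlgebraicGeometry.Frobenioids
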